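import Summits.KontsevichZagierPeriods.KontsevichZagierPeriods.Theorems.SoloInformedAlgDenCalculus
import Summits.KontsevichZagierPeriods.KontsevichZagierPeriods.Theorems.SoloInformedToricBoxSplit
import HarnessLib

/-!
# RULE SPLIT over a field of real algebraic numbers: cutting the cube at an algebraic abscissa

Solo programme `solo-KontsevichZagierPeriods-informed`, session s107: the re-base of the
DEN-calculus on a coefficient field `K` of real algebraic numbers
(`hK : ∀ c, IsAlgebraic ℚ (algebraMap K ℝ c)`), step 8.  This is the step the `ℚ`-calculus
(`SoloInformedToricBoxSplit`) could not type: the resolution of `(2x₀² − 1)² + x₁` must cut the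
square at the IRRATIONAL algebraic abscissa `x₀ = 1/√2`, and the rescaled halves then have
coefficients in `ℚ(√2)`.  Over `K` the cut `x_i = c` is allowed at every `c ∈ K`, `0 < c < 1`.

* `soloInformedScaleMoveR i α β` (`x_i ↦ α + β·x_i`, real parameters), its derivative
  `soloInformedScaleDerivR` (`det = β`), injectivity, image = the slab
  `soloInformedSlabR i α β = {x ∈ (0,1)ⁿ : α < x_i < α + β}`; for `α, β ∈ K` the move is a
  `ℚ`-semialgebraic map and the slab a `ℚ`-semialgebraic set (LEMMA ALG-COEFF);
* `soloInformedScaleSubstK i a b = bind₁ (x_i ↦ C a + C b·x_i)` on `K[x]`;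
* **RULE SPLIT over `K`** `soloInformed_presentableDenK_of_split`: if `Q ≠ 0` on
  `(0,1)ⁿ ∖ {x_i = c}` and both rescaled halves are presentable denominators, so is `Q`;
* RULE UNIT `soloInformed_presentableDenK_C_mul` and RULE VERTEX′
  `soloInformed_presentableDenK_of_eq_vertexMove`.

References: M. Kontsevich, D. Zagier, *Periods* (2001) §1.1 (algebraic coefficients allowed),
§1.2 rules (1a), (2); J. Ayoub, EMS Newsl. 91 (2014) §2.2.
-/

noncomputable section

open scoped BigOperators
open MeasureTheory Set
open Literature.NumberTheory.Transcendental Literature.NumberTheory.Transcendental.KZ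
open Literature.ModelTheory.ExponentialFields (IsSemialgebraic)

namespace Summit.KontsevichZagierPeriods.KontsevichZagierPeriods.Theorems

variable {n : ℕ} {K : Type*} [Field K] [Algebra K ℝ]

/-! ## The affine rescaling of one coordinate, real parameters -/

/-- `Λ_{i,α,β} : x_i ↦ α + β·x_i`, the other coordinates fixed (real parameters). -/
def soloInformedScaleMoveR (i : Fin n) (α β : ℝ) (x : Fin n → ℝ) : Fin n → ℝ :=
  fun j => if j = i then α + β * x j else x j

/-- The moved coordinate. -/
theorem soloInformed_scaleMoveR_apply_self (i : Fin n) (α β : ℝ) (x : Fin n → ℝ) :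
    soloInformedScaleMoveR i α β x i = α + β * x i := by
  simp [soloInformedScaleMoveR]

/-- The fixed coordinates. -/
theorem soloInformed_scaleMoveR_apply_ne (i : Fin n) (α β : ℝ) (x : Fin n → ℝ) {j : Fin n}
    (hj : j ≠ i) : soloInformedScaleMoveR i α β x j = x j := by
  simp [soloInformedScaleMoveR, hj]

/-- The scale move is injective for `β ≠ 0`. -/
theorem soloInformed_scaleMoveR_injective (i : Fin n) {α β : ℝ} (hβ : β ≠ 0) :
    Function.Injective (soloInformedScaleMoveR i α β) := fun x y h => by
  funext j
  have hj := congr_fun h j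
  by_cases hji : j = i
  · subst hji
    rw [soloInformed_scaleMoveR_apply_self, soloInformed_scaleMoveR_apply_self] at hj
    exact mul_left_cancel₀ hβ (add_left_cancel hj)
  · rwa [soloInformed_scaleMoveR_apply_ne i α β x hji,
      soloInformed_scaleMoveR_apply_ne i α β y hji] at hj

/-- The (constant) derivative `diag(1, …, β, …, 1)` of the scale move. -/
def soloInformedScaleDerivR (i : Fin n) (β : ℝ) : (Fin n → ℝ) →L[ℝ] (Fin n → ℝ) :=
  ContinuousLinearMap.pi fun j =>
    if j = i then β • ContinuousLinearMap.proj (R := ℝ) (φ := fun _ : Fin n => ℝ) j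
    else ContinuousLinearMap.proj (R := ℝ) (φ := fun _ : Fin n => ℝ) j

/-- Components of the derivative of the scale move. -/
theorem soloInformed_scaleDerivR_apply (i : Fin n) (β : ℝ) (v : Fin n → ℝ) (j : Fin n) :
    soloInformedScaleDerivR i β v j = if j = i then β * v j else v j := by
  unfold soloInformedScaleDerivR
  rw [ContinuousLinearMap.pi_apply]
  by_cases hj : j = i <;> simp [hj]

/-- `det diag(1, …, β, …, 1) = β`. -/
theorem soloInformed_det_scaleDerivR (i : Fin n) (β : ℝ) :
    (soloInformedScaleDerivR i β).det = β := by
  have hmat : ((soloInformedScaleDerivR i β : (Fin n → ℝ) →L[ℝ] (Fin n → ℝ)) :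
      (Fin n → ℝ) →ₗ[ℝ] (Fin n → ℝ)) =
      Matrix.toLin' (Matrix.diagonal fun j : Fin n => if j = i then β else 1) := by
    refine LinearMap.ext fun v => funext fun j => ?_
    rw [ContinuousLinearMap.coe_coe, soloInformed_scaleDerivR_apply, Matrix.toLin'_apply,
      Matrix.mulVec_diagonal]
    by_cases hj : j = i <;> simp [hj]
  change LinearMap.det _ = _
  rw [hmat, LinearMap.det_toLin', Matrix.det_diagonal]
  simp

/-- The scale move has derivative `diag(1, …, β, …, 1)` everywhere. -/
theorem soloInformed_hasFDerivAt_scaleMoveR (i : Fin n) (α β : ℝ) (x : Fin n → ℝ) :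
    HasFDerivAt (soloInformedScaleMoveR i α β) (soloInformedScaleDerivR i β) x := by
  unfold soloInformedScaleMoveR soloInformedScaleDerivR
  refine hasFDerivAt_pi.2 fun j => ?_
  by_cases hj : j = i
  · simp only [hj, if_true]
    exact ((hasFDerivAt_apply i x).const_mul β).const_add α
  · simp only [hj, if_false]
    exact hasFDerivAt_apply j x

/-- For `a, b ∈ K` the scale move `Λ_{i,a,b}` is a `ℚ`-semialgebraic map on every
`ℚ`-semialgebraic set: its coordinates are `K`-polynomial functions (LEMMA ALG-COEFF).
[Kontsevich–Zagier 2001 §1.1] -/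
theorem soloInformed_isSemialgebraicMapOn_scaleMoveK
    (hK : ∀ c : K, IsAlgebraic ℚ (algebraMap K ℝ c)) (i : Fin n) (a b : K)
    {s : Set (Fin n → ℝ)} (hs : IsSemialgebraic ℚ s) :
    IsSemialgebraicMapOn ℚ s
      (soloInformedScaleMoveR i (algebraMap K ℝ a) (algebraMap K ℝ b)) :=
  IsSemialgebraicMapOn.of_forall hs fun j =>
    (soloInformed_isSemialgebraicFunOn_aevalK hK hs
      (if j = i then MvPolynomial.C a + MvPolynomial.C b * MvPolynomial.X j else MvPolynomial.X j :
        MvPolynomial (Fin n) K)).congr fun x _ => by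
      by_cases hj : j = i <;> simp [soloInformedScaleMoveR, hj]

/-- The rescaled polynomial `P ↦ P(Λ_{i,a,b} x)` (an algebra endomorphism of `K[x]`). -/
def soloInformedScaleSubstK (i : Fin n) (a b : K) :
    MvPolynomial (Fin n) K →ₐ[K] MvPolynomial (Fin n) K :=
  MvPolynomial.bind₁ fun j =>
    if j = i then MvPolynomial.C a + MvPolynomial.C b * MvPolynomial.X j else MvPolynomial.X j

/-- Evaluating the rescaled polynomial is evaluating at the moved point. -/
theorem soloInformed_aeval_scaleSubstK (i : Fin n) (a b : K) (x : Fin n → ℝ)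
    (P : MvPolynomial (Fin n) K) :
    (MvPolynomial.aeval x (soloInformedScaleSubstK i a b P) : ℝ) =
      MvPolynomial.aeval (soloInformedScaleMoveR i (algebraMap K ℝ a) (algebraMap K ℝ b) x) P := by
  unfold soloInformedScaleSubstK
  rw [MvPolynomial.aeval_bind₁]
  have h : (fun j => (MvPolynomial.aeval x
      (if j = i then MvPolynomial.C a + MvPolynomial.C b * MvPolynomial.X j else MvPolynomial.X j :
        MvPolynomial (Fin n) K) : ℝ)) =
      soloInformedScaleMoveR i (algebraMap K ℝ a) (algebraMap K ℝ b) x := by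
    funext j
    by_cases hj : j = i <;> simp [soloInformedScaleMoveR, hj]
  rw [h]

/-! ## Slabs: the images of the open cube -/

/-- The slab `{x ∈ (0,1)ⁿ : α < x_i < α + β}` (real parameters). -/
def soloInformedSlabR (i : Fin n) (α β : ℝ) : Set (Fin n → ℝ) :=
  {x | x ∈ soloInformedOpenCube n ∧ α < x i ∧ x i < α + β}

/-- Slabs lie in the open cube. -/
theorem soloInformedSlabR_subset_openCube (i : Fin n) (α β : ℝ) :
    soloInformedSlabR i α β ⊆ soloInformedOpenCube n := fun _ hx => hx.1

/-- Slabs with endpoints in `K` are `ℚ`-semialgebraic: `{α − x_i < 0}` and `{x_i − (α+β) < 0}`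
are negativity sets of `K`-polynomial functions (LEMMA ALG-COEFF). [BCR 1998, §2.2] -/
theorem isSemialgebraic_soloInformedSlabK (hK : ∀ c : K, IsAlgebraic ℚ (algebraMap K ℝ c))
    (i : Fin n) (a b : K) :
    IsSemialgebraic ℚ (soloInformedSlabR i (algebraMap K ℝ a) (algebraMap K ℝ b)) := by
  have hO := isSemialgebraic_soloInformedOpenCube n
  have h1 : IsSemialgebraic ℚ {x : Fin n → ℝ | x ∈ soloInformedOpenCube n ∧
      (MvPolynomial.aeval x (MvPolynomial.C a - MvPolynomial.X i : MvPolynomial (Fin n) K) : ℝ)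
        < 0} :=
    (soloInformed_isSemialgebraicFunOn_aevalK hK hO _).isSemialgebraic_sep_neg
  have h2 : IsSemialgebraic ℚ {x : Fin n → ℝ | x ∈ soloInformedOpenCube n ∧
      (MvPolynomial.aeval x (MvPolynomial.X i - MvPolynomial.C (a + b) :
        MvPolynomial (Fin n) K) : ℝ) < 0} :=
    (soloInformed_isSemialgebraicFunOn_aevalK hK hO _).isSemialgebraic_sep_neg
  have hset : soloInformedSlabR i (algebraMap K ℝ a) (algebraMap K ℝ b) =
      {x : Fin n → ℝ | x ∈ soloInformedOpenCube n ∧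
        (MvPolynomial.aeval x (MvPolynomial.C a - MvPolynomial.X i : MvPolynomial (Fin n) K) : ℝ)
          < 0} ∩
      {x : Fin n → ℝ | x ∈ soloInformedOpenCube n ∧
        (MvPolynomial.aeval x (MvPolynomial.X i - MvPolynomial.C (a + b) :
          MvPolynomial (Fin n) K) : ℝ) < 0} := by
    ext x
    simp only [soloInformedSlabR, mem_setOf_eq, mem_inter_iff, map_sub, MvPolynomial.aeval_C,
      MvPolynomial.aeval_X, map_add, sub_neg]
    tauto
  rw [hset]
  exact h1.inter h2

/-- For `0 ≤ α`, `0 < β`, `α + β ≤ 1` the scale move maps the open cube into the slab. -/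
theorem soloInformed_scaleMoveR_mem (i : Fin n) {α β : ℝ} (hα : 0 ≤ α) (hβ : 0 < β)
    (hαβ : α + β ≤ 1) {x : Fin n → ℝ} (hx : x ∈ soloInformedOpenCube n) :
    soloInformedScaleMoveR i α β x ∈ soloInformedSlabR i α β := by
  have h1 : α < α + β * x i := lt_add_of_pos_right _ (mul_pos hβ (hx i).1)
  have h2 : α + β * x i < α + β := by
    have := mul_lt_of_lt_one_right hβ (hx i).2
    linarith
  refine ⟨fun j => ?_, ?_, ?_⟩
  · by_cases hj : j = i
    · rw [hj, soloInformed_scaleMoveR_apply_self]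
      exact ⟨lt_of_le_of_lt hα h1, lt_of_lt_of_le h2 hαβ⟩
    · rw [soloInformed_scaleMoveR_apply_ne i α β x hj]
      exact hx j
  · rw [soloInformed_scaleMoveR_apply_self]; exact h1
  · rw [soloInformed_scaleMoveR_apply_self]; exact h2

/-- For `0 ≤ α`, `0 < β`, `α + β ≤ 1` the scale move maps the open cube ONTO the slab. -/
theorem soloInformed_image_scaleMoveR (i : Fin n) {α β : ℝ} (hα : 0 ≤ α) (hβ : 0 < β)
    (hαβ : α + β ≤ 1) :
    soloInformedScaleMoveR i α β '' soloInformedOpenCube n = soloInformedSlabR i α β := by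
  refine Subset.antisymm
    (image_subset_iff.2 fun x hx => soloInformed_scaleMoveR_mem i hα hβ hαβ hx) fun x hx => ?_
  have hβ0 : β ≠ 0 := hβ.ne'
  refine ⟨fun j => if j = i then (x i - α) / β else x j, fun j => ?_, ?_⟩
  · by_cases hj : j = i
    · simp only [hj, if_true]
      exact ⟨div_pos (sub_pos.2 hx.2.1) hβ, (div_lt_one hβ).2 (by linarith [hx.2.2])⟩
    · simp only [hj, if_false]
      exact hx.1 j
  · funext j
    by_cases hj : j = i
    · rw [hj, soloInformed_scaleMoveR_apply_self]
      simp only [if_true]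
      field_simp
      ring
    · rw [soloInformed_scaleMoveR_apply_ne i α β _ hj]
      simp only [hj, if_false]

/-! ## Transport along a scale move and RULE SPLIT over `K` -/

/-- **Rule (2) along a scale move**, `K`-coefficients.  If `Q ≠ 0` on the slab of `Λ_{i,a,b}`
and the rescaled denominator `scaleSubstK i a b Q` is a presentable denominator, then the
restriction to the slab of every `IntegralRep` on `(0,1)ⁿ` with integrand `P/Q` is presentable
(pull back along `Λ_{i,a,b}`, Jacobian `b`). [this work] -/
theorem soloInformed_presentable_restrict_slabK
    (hK : ∀ c : K, IsAlgebraic ℚ (algebraMap K ℝ c)) (i : Fin n) {a b : K}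
    (ha : 0 ≤ algebraMap K ℝ a) (hb : 0 < algebraMap K ℝ b)
    (hab : algebraMap K ℝ a + algebraMap K ℝ b ≤ 1) (P Q : MvPolynomial (Fin n) K)
    (hQ : ∀ x ∈ soloInformedSlabR i (algebraMap K ℝ a) (algebraMap K ℝ b),
      (MvPolynomial.aeval x Q : ℝ) ≠ 0)
    (hS : SoloInformedPresentableDenK (soloInformedScaleSubstK i a b Q)) (ρ : IntegralRep n)
    (hρi : EqOn ρ.integrand (fun x => (MvPolynomial.aeval x P : ℝ) / MvPolynomial.aeval x Q)
      (soloInformedOpenCube n))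
    (hD : soloInformedSlabR i (algebraMap K ℝ a) (algebraMap K ℝ b) ⊆ ρ.domain) :
    of (ρ.restrict (soloInformedSlabR i (algebraMap K ℝ a) (algebraMap K ℝ b))
      (isSemialgebraic_soloInformedSlabK hK i a b) hD) ∈ soloInformedPresentable := by
  set α : ℝ := algebraMap K ℝ a with hαdef
  set β : ℝ := algebraMap K ℝ b with hβdef
  have hQt : ∀ x ∈ soloInformedOpenCube n,
      (MvPolynomial.aeval x (soloInformedScaleSubstK i a b Q) : ℝ) ≠ 0 := fun x hx => by
    rw [soloInformed_aeval_scaleSubstK]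
    exact hQ _ (soloInformed_scaleMoveR_mem i ha hb hab hx)
  have hmeas : MeasurableSet (soloInformedOpenCube n) := by
    rw [soloInformedOpenCube_eq_pi]; exact MeasurableSet.univ_pi fun _ => measurableSet_Ioo
  have hderiv : ∀ x ∈ soloInformedOpenCube n, HasFDerivWithinAt (soloInformedScaleMoveR i α β)
      (soloInformedScaleDerivR i β) (soloInformedOpenCube n) x :=
    fun x _ => (soloInformed_hasFDerivAt_scaleMoveR i α β x).hasFDerivWithinAt
  have hinj : InjOn (soloInformedScaleMoveR i α β) (soloInformedOpenCube n) :=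
    (soloInformed_scaleMoveR_injective i hb.ne').injOn
  have habs : |(soloInformedScaleDerivR i β).det| = β := by
    rw [soloInformed_det_scaleDerivR]; exact abs_of_pos hb
  have hdom : (ρ.restrict (soloInformedSlabR i α β) (isSemialgebraic_soloInformedSlabK hK i a b)
      hD).domain = soloInformedScaleMoveR i α β '' soloInformedOpenCube n := by
    rw [soloInformed_image_scaleMoveR i ha hb hab]; rfl
  have hform : ∀ x ∈ soloInformedOpenCube n,
      (MvPolynomial.aeval x (MvPolynomial.C b * soloInformedScaleSubstK i a b P) : ℝ) /
          MvPolynomial.aeval x (soloInformedScaleSubstK i a b Q) =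
        ρ.integrand (soloInformedScaleMoveR i α β x) * |(soloInformedScaleDerivR i β).det| :=
    fun x hx => by
      rw [habs, hρi (soloInformed_scaleMoveR_mem i ha hb hab hx).1, map_mul, MvPolynomial.aeval_C,
        soloInformed_aeval_scaleSubstK, soloInformed_aeval_scaleSubstK]
      ring
  have hint1 : IntegrableOn (fun x => |(soloInformedScaleDerivR i β).det| •
      ρ.integrand (soloInformedScaleMoveR i α β x)) (soloInformedOpenCube n) := by
    have h := (ρ.restrict (soloInformedSlabR i α β) (isSemialgebraic_soloInformedSlabK hK i a b)
      hD).integrableOn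
    rw [hdom, integrableOn_image_iff_integrableOn_abs_det_fderiv_smul volume hmeas hderiv hinj]
      at h
    exact h
  have hint' : IntegrableOn (fun x =>
      (MvPolynomial.aeval x (MvPolynomial.C b * soloInformedScaleSubstK i a b P) : ℝ) /
        MvPolynomial.aeval x (soloInformedScaleSubstK i a b Q)) (soloInformedOpenCube n) :=
    hint1.congr_fun (fun x hx => by
      show |(soloInformedScaleDerivR i β).det| • ρ.integrand (soloInformedScaleMoveR i α β x) = _
      rw [hform x hx, smul_eq_mul, mul_comm]) hmeas
  set ρt := soloInformedOfRationalK hK (soloInformedOpenCube n)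
      (MvPolynomial.C b * soloInformedScaleSubstK i a b P) (soloInformedScaleSubstK i a b Q)
      (isSemialgebraic_soloInformedOpenCube n) hQt hint' with hρt
  have h2 : of ρt - of (ρ.restrict (soloInformedSlabR i α β)
      (isSemialgebraic_soloInformedSlabK hK i a b) hD) ∈ relations := by
    refine changeOfVariablesRel_subset_relations ⟨n, ρt, _, soloInformedScaleMoveR i α β,
      fun _ => soloInformedScaleDerivR i β,
      soloInformed_isSemialgebraicMapOn_scaleMoveK hK i a b (isSemialgebraic_soloInformedOpenCube n),
      hderiv, hinj, hdom, fun x hx => ?_, rfl⟩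
    have hx' : x ∈ soloInformedOpenCube n := hx
    show (MvPolynomial.aeval x (MvPolynomial.C b * soloInformedScaleSubstK i a b P) : ℝ) /
        MvPolynomial.aeval x (soloInformedScaleSubstK i a b Q) = _
    exact hform x hx'
  have hpres : of ρt ∈ soloInformedPresentable :=
    hS (MvPolynomial.C b * soloInformedScaleSubstK i a b P) ρt subset_rfl
      (soloInformedOpenCube_subset_cube n) fun _ _ => rfl
  rw [← neg_sub] at h2
  exact soloInformed_presentable_of_sub_mem (by simpa using relations.neg_mem h2) hpres

/-- **RULE SPLIT over `K`.**  Let `c ∈ K` with `0 < c < 1` in `ℝ` and suppose `Q ≠ 0` on `(0,1)ⁿ`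
off the hyperplane `x_i = c`.  If both rescaled halves `Q(…, c·x_i, …)` and
`Q(…, c + (1−c)·x_i, …)` are presentable denominators, then so is `Q`: rule (1a) along the null
hyperplane `x_i = c` and rule (2) along the two scale moves.  New over `K`: `c` may be an
irrational algebraic number. [this work] -/
theorem soloInformed_presentableDenK_of_split
    (hK : ∀ c : K, IsAlgebraic ℚ (algebraMap K ℝ c)) (i : Fin n) (c : K)
    (hc0 : 0 < algebraMap K ℝ c) (hc1 : algebraMap K ℝ c < 1) {Q : MvPolynomial (Fin n) K}
    (hQ : ∀ x ∈ soloInformedOpenCube n, x i ≠ algebraMap K ℝ c →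
      (MvPolynomial.aeval x Q : ℝ) ≠ 0)
    (h₁ : SoloInformedPresentableDenK (soloInformedScaleSubstK i 0 c Q))
    (h₂ : SoloInformedPresentableDenK (soloInformedScaleSubstK i c (1 - c) Q)) :
    SoloInformedPresentableDenK Q := by
  have h0 : algebraMap K ℝ (0 : K) = 0 := map_zero _
  have h1c : algebraMap K ℝ (1 - c) = 1 - algebraMap K ℝ c := by rw [map_sub, map_one]
  refine soloInformed_presentableDenK_of_open Q fun P ρ hρ hρi => ?_
  have hD₁ : soloInformedSlabR i (algebraMap K ℝ 0) (algebraMap K ℝ c) ⊆ ρ.domain := by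
    rw [hρ]; exact soloInformedSlabR_subset_openCube i _ _
  have hD₂ : soloInformedSlabR i (algebraMap K ℝ c) (algebraMap K ℝ (1 - c)) ⊆ ρ.domain := by
    rw [hρ]; exact soloInformedSlabR_subset_openCube i _ _
  have hQ₁ : ∀ x ∈ soloInformedSlabR i (algebraMap K ℝ 0) (algebraMap K ℝ c),
      (MvPolynomial.aeval x Q : ℝ) ≠ 0 := fun x hx =>
    hQ x hx.1 (by have h := hx.2.2; rw [h0, zero_add] at h; exact ne_of_lt h)
  have hQ₂ : ∀ x ∈ soloInformedSlabR i (algebraMap K ℝ c) (algebraMap K ℝ (1 - c)),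
      (MvPolynomial.aeval x Q : ℝ) ≠ 0 := fun x hx =>
    hQ x hx.1 (ne_of_gt hx.2.1)
  refine soloInformed_presentable_of_cover ρ (isSemialgebraic_soloInformedSlabK hK i 0 c)
    (isSemialgebraic_soloInformedSlabK hK i c (1 - c)) hD₁ hD₂ ?_ ?_
    (soloInformed_presentable_restrict_slabK hK i (by rw [h0]) hc0 (by rw [h0, zero_add]; exact hc1.le)
      P Q hQ₁ h₁ ρ hρi hD₁)
    (soloInformed_presentable_restrict_slabK hK i hc0.le (by rw [h1c]; linarith)
      (by rw [h1c]; linarith) P Q hQ₂ h₂ ρ hρi hD₂)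
  · refine measure_mono_null (fun x hx => ?_) (measure_empty (μ := volume (α := Fin n → ℝ)))
    have h1 := hx.1.2.2
    have h2 := hx.2.2.1
    rw [h0, zero_add] at h1
    exact absurd (h1.trans h2) (lt_irrefl (x i))
  · refine measure_mono_null (fun x hx => ?_)
      (soloInformed_volume_hyperplane i (algebraMap K ℝ c))
    have hxO : x ∈ soloInformedOpenCube n := hρ ▸ hx.1
    by_contra hne
    rcases lt_or_gt_of_ne hne with hlt | hgt
    · exact hx.2 (Or.inl ⟨hxO, by rw [h0]; exact (hxO i).1, by rwa [h0, zero_add]⟩)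
    · exact hx.2 (Or.inr ⟨hxO, hgt, by rw [h1c]; linarith [(hxO i).2]⟩)

/-! ## Two small rules -/

/-- RULE UNIT over `K`: scaling the denominator by a constant `u ∈ K` (absorbed by the numerator
as `u⁻¹`; for `u = 0` both sides are the zero integrand). [this work] -/
theorem soloInformed_presentableDenK_C_mul {Q : MvPolynomial (Fin n) K} (u : K)
    (h : SoloInformedPresentableDenK Q) :
    SoloInformedPresentableDenK (MvPolynomial.C u * Q) := by
  intro P r hO hC hri
  refine h (MvPolynomial.C u⁻¹ * P) r hO hC fun x hx => ?_
  rw [hri hx]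
  show (MvPolynomial.aeval x P : ℝ) / MvPolynomial.aeval x (MvPolynomial.C u * Q) =
    MvPolynomial.aeval x (MvPolynomial.C u⁻¹ * P) / MvPolynomial.aeval x Q
  simp only [map_mul, MvPolynomial.aeval_C, map_inv₀]
  ring

/-- RULE VERTEX′ over `K`: a polynomial `T` whose function on `(0,1)ⁿ` is `x ↦ B(Φ_S x)` for a
presentable denominator `B` non-vanishing on `(0,1)ⁿ` is a presentable denominator.
[this work] -/
theorem soloInformed_presentableDenK_of_eq_vertexMove
    (hK : ∀ c : K, IsAlgebraic ℚ (algebraMap K ℝ c)) (S : Finset (Fin n))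
    {B T : MvPolynomial (Fin n) K} (hB : SoloInformedPresentableDenK B)
    (hB0 : ∀ x ∈ soloInformedOpenCube n, (MvPolynomial.aeval x B : ℝ) ≠ 0)
    (hT : ∀ x ∈ soloInformedOpenCube n,
      (MvPolynomial.aeval x T : ℝ) = MvPolynomial.aeval (soloInformedVertexMove S x) B) :
    SoloInformedPresentableDenK T := by
  refine soloInformed_presentableDenK_of_vertexReflect hK S (fun x hx => ?_)
    (soloInformed_presentableDenK_congr (fun x hx => ?_) hB)
  · rw [hT x hx]; exact hB0 _ (soloInformed_vertexMove_mem S hx)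
  · rw [soloInformed_aeval_vertexReflectK, hT _ (soloInformed_vertexMove_mem S hx),
      soloInformed_vertexMove_vertexMove]

end Summit.KontsevichZagierPeriods.KontsevichZagierPeriods.Theorems
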